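import Summits.CriticalPhenomena.PercolationContinuityZ3.Theorems.PercNearOneGluingNoHeavyLowerTailSunflowerMultiPetalKempeMarkedTIRowsNear
import HarnessLib
import HarnessLib.Audit

/-!
# `NoHeavyLowerTail` (crux stmt-CriticalPhenomena-4575), marked multigraphs, THEOREM TI2: the `|S| = 1` STEP for the weighted functional —
# row identities, `Φ_u`-pairing, and the step inequalities at a `y ∼ u` with exactly one outer neighbour

Support file (seat `prim-l12-p2` gen 52; `--supports stmt-CriticalPhenomena-4575`; continuation of `…KempeMarkedTIRowsNear` / `…TIRows` (finite paired-row
checks) and `…TICells` (weighted cells); the unweighted model is g49's `…KempeMarkedStepOne`, p607581).  No `sorry`; nothing is asserted about the crux.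
Memo: run/shared/lean/prim/prim-l12/prim-l12-p2/PROOF-TI2-MARKED-MULTIGRAPHS-g51.md §3, `d = 1`.

For terminals `u ≠ v`, weight colour `c ∈ {0,1}`, special vertex `s ∉ {u,v,y}`, an unmarked `y ∼ u` with `S = N(y) ∖ {u,v} = {s'}`:
* `resWL` — the weighted residual with law coefficients, `Σ_ρ resWL α βK b = α·(3·TI(K) − TI(K−y)) + βK·TI(K−y) − b·AZW` (`sum_resWL_eq`);
* `sum_resWL_update_far` / `sum_resW_update_near` — ROW IDENTITIES: the three cells `ρ[s' ↦ c']` sum to `rowFarW …` (special vertex far) resp.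
  `rowNearW c …` (special vertex `= s'`), at g49's base type / profile / flags;
* `sum_nonneg_of_row_pairs` — three-to-one plus the involution `Φ_u`: paired rows `≥ 0` ⇒ `Σ_ρ ≥ 0`;
* **the step inequalities**: `TIfun_stepOne_near` and `TIfun_stepOne_far_one`/`_far_zero_pos` (law `(1,1)`: `TI(K−y) + AZW ≤ 3·TI(K)`), and
  `TIfun_stepOne_far_zero_zero` (weight at `u`, `s` far, `y ≁ v`: law `(4/3, 2/3)`, i.e. `4·TI(K−y) + 2·AZW ≤ 9·TI(K)`).
-/

namespace Summit.CriticalPhenomena.PercolationContinuityZ3.Theorems.SunflowerPartition.Kempe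

open Finset

/-- The weighted kernel as weight × `fC` of the shifted type. (finite check) [this work] -/
theorem hWt_eq_mul_fC : ∀ (c : Fin 3) (t : CType) (z : Fin 3),
    hWt c t z = (if z = c then 1 else 2) * fC (ctAdd t (if z = c then xPart c (1, 1, 1) else (0, 0, 0))) := by decide

/-- `ctAdd t 0 = t`. (finite check) [this work] -/
theorem ctAdd_zero_triple : ∀ t : CType, ctAdd t (0, 0, 0) = t := by decide

/-- Twice g49's paired inequality. [this work] -/
theorem two_mul_single_pair_nonneg (A B C : Fin 3) (hA : A ≠ 0) (hC : C ≠ 0) (Ia Ic P P' B₁ N Ta Tb Tc : Fin 3) :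
    0 ≤ 2 * rowD1 (capAdd Ia P, B₁, Ic) (capAdd N Ta, Tb, Tc) A B C + 2 * rowD1 (capAdd Ic P', B₁, Ia) (capAdd N Tc, Tb, Ta) A B C := by
  have := single_pair_nonneg A B C hA hC Ia Ic P P' B₁ N Ta Tb Tc
  linarith

/-- The law-`(1,1)` far row is a multiple of g49's row at the shifted base type. [this work] -/
theorem rowFarW_eq_mul_rowD1 (w : ℤ) (e t φ : CType) (A B C : Fin 3) : rowFarW w 1 (-1) 0 e t φ A B C = w * rowD1 (ctAdd t e) φ A B C := by
  unfold rowFarW cellW rowD1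
  rw [ctAdd_right_comm t (xPart 0 φ) e, ctAdd_right_comm t (xPart 1 φ) e, ctAdd_right_comm t (xPart 2 φ) e]
  ring

namespace MGraph

variable {V : Type*} [Fintype V] [LinearOrder V] (K : MGraph V)

section StepOneW

/-- The weighted residual WITH LAW COEFFICIENTS: `α·WK + βK·hWt(type_{K−y}) − b·[ρ ≡ 0 on S]·hWt(type_{K−y})`. [this work] -/
def resWL (c : Fin 3) (y : V) (S : Finset V) (s : V) (α βK b : ℤ) (ρ : V → Fin 3) : ℤ :=
  α * K.WK c y s ρ + βK * hWt c ((K.isolate y).ctypeM ρ) (ρ s) - b * (if ∀ s'' ∈ S, ρ s'' = 0 then hWt c ((K.isolate y).ctypeM ρ) (ρ s) else 0)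

variable {K}
variable {u v y s s' : V} {c : Fin 3}

/-- `Σ_ρ resWL α βK b = α·(3·TI(K) − TI(K.isolate y)) + βK·TI(K.isolate y) − b·AZW`. [this work] -/
theorem sum_resWL_eq (S : Finset V) (hys : y ≠ s) (hyu : y ≠ u) (hyv : y ≠ v) (α βK b : ℤ) :
    ∑ ρ ∈ univ.filter (fun ρ : V → Fin 3 => ρ u = 0 ∧ ρ v = 1), K.resWL c y S s α βK b ρ
      = α * (3 * K.TIfun c s u v - (K.isolate y).TIfun c s u v) + βK * (K.isolate y).TIfun c s u v - b * K.AZW c y S s u v := by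
  rw [← K.sum_WK_eq hys hyu hyv]
  unfold resWL TIfun AZW
  rw [sum_sub_distrib, sum_add_distrib, ← mul_sum, ← mul_sum, ← mul_sum]

/-- The law-`(1,1)` residual is `resW`. [this work] -/
theorem resW_eq_resWL (hc : c = 0 ∨ c = 1) (S : Finset V) (hyu : y ≠ u) (hyv : y ≠ v) (ρ : V → Fin 3) (hu : ρ u = 0) (hv : ρ v = 1) :
    K.resW c y S s u v ρ = K.resWL c y S s 1 0 1 ρ := by
  rw [K.resW_eq hc hyu hyv ρ hu hv]
  unfold resWL
  ring

/-- The type of `ρ[s' ↦ c']` in `K − y` and the profile of `y` there (g49's bookkeeping, restated). [this work] -/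
theorem ctypeM_isolate_update_eq (ρ : V → Fin 3) (c' : Fin 3) :
    (K.isolate y).ctypeM (Function.update ρ s' c') = ctAdd (((K.isolate y).isolate s').ctypeM ρ) (xPart c' ((K.isolate y).profM s' ρ)) := by
  rw [(K.isolate y).ctypeM_eq_ctAdd_isolate s' (Function.update ρ s' c'), Function.update_self, (K.isolate y).ctypeM_isolate_update s' ρ c',
    (K.isolate y).profM_update_self s' ρ c']

/-- **FAR ROW IDENTITY** (`S = {s'}`, `s ∉ {s', u, v, y}`): the cells `ρ[s' ↦ c']` of `resWL α βK b` sum to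
`rowFarW w α (βK − b) βK e t₀ φ A B C` with `(w, e) = (1, e_c)` if `ρ s = c` and `(2, 0)` otherwise. [this work] -/
theorem sum_resWL_update_far (hS : ∀ w, w ∈ ({s'} : Finset V) ↔ (w ≠ u ∧ w ≠ v ∧ w ≠ y ∧ K.mul y w ≠ 0)) (huv : u ≠ v) (hyu : y ≠ u)
    (hyv : y ≠ v) (hmy : K.mark y = 0) (hss' : s ≠ s') (ρ : V → Fin 3) (hu : ρ u = 0) (hv : ρ v = 1) (α βK b : ℤ) :
    ∑ c' : Fin 3, K.resWL c y {s'} s α βK b (Function.update ρ s' c')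
      = rowFarW (if ρ s = c then 1 else 2) α (βK - b) βK (if ρ s = c then xPart c (1, 1, 1) else (0, 0, 0))
          (((K.isolate y).isolate s').ctypeM ρ) ((K.isolate y).profM s' ρ) (cap3 (K.mul y u)) (cap3 (K.mul y v)) (cap3 (K.mul y s')) := by
  have hsz : ∀ c' : Fin 3, Function.update ρ s' c' s = ρ s := fun c' => Function.update_of_ne hss' _ _
  have h10 : ¬((1 : Fin 3) = 0) := by decide
  have h20 : ¬((2 : Fin 3) = 0) := by decide
  have h01 : ¬((0 : Fin 3) = 1) := by decide
  have h02 : ¬((0 : Fin 3) = 2) := by decide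
  have h12 : ¬((1 : Fin 3) = 2) := by decide
  have h21 : ¬((2 : Fin 3) = 1) := by decide
  rw [Fin.sum_univ_three]
  unfold resWL rowFarW cellW
  rw [K.WK_eq, K.WK_eq, K.WK_eq, hsz 0, hsz 1, hsz 2, ctypeM_isolate_update_eq ρ 0, ctypeM_isolate_update_eq ρ 1, ctypeM_isolate_update_eq ρ 2,
    profM_update_eq hS huv hyu hyv hmy ρ hu hv 0, profM_update_eq hS huv hyu hyv hmy ρ hu hv 1, profM_update_eq hS huv hyu hyv hmy ρ hu hv 2]
  simp only [hWt_eq_mul_fC, mem_singleton, forall_eq, Function.update_self, if_true, h10, h20, h01, h02, h12, h21, if_false,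
    MGraph.capAdd_zero_right]
  by_cases h : ρ s = c
  · simp only [h, if_true]; ring
  · simp only [h, if_false, ctAdd_zero_triple]; ring

/-- **NEAR ROW IDENTITY** (`S = {s}`): the cells `ρ[s ↦ c']` of `resW` sum to `rowNearW c t₀ φ A B C` (`c ∈ {0,1}`). [this work] -/
theorem sum_resW_update_near (hc : c = 0 ∨ c = 1) (hS : ∀ w, w ∈ ({s} : Finset V) ↔ (w ≠ u ∧ w ≠ v ∧ w ≠ y ∧ K.mul y w ≠ 0)) (huv : u ≠ v)
    (hyu : y ≠ u) (hyv : y ≠ v) (hmy : K.mark y = 0) (ρ : V → Fin 3) (hu : ρ u = 0) (hv : ρ v = 1) :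
    ∑ c' : Fin 3, K.resW c y {s} s u v (Function.update ρ s c')
      = rowNearW c (((K.isolate y).isolate s).ctypeM ρ) ((K.isolate y).profM s ρ) (cap3 (K.mul y u)) (cap3 (K.mul y v)) (cap3 (K.mul y s)) := by
  have hsu : s ≠ u := ((hS s).1 (mem_singleton_self s)).1
  have hsv : s ≠ v := ((hS s).1 (mem_singleton_self s)).2.1
  have hF : ∀ c' : Fin 3, Function.update ρ s c' u = 0 ∧ Function.update ρ s c' v = 1 := fun c' =>
    ⟨by rw [Function.update_of_ne hsu.symm, hu], by rw [Function.update_of_ne hsv.symm, hv]⟩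
  have h10 : ¬((1 : Fin 3) = 0) := by decide
  have h20 : ¬((2 : Fin 3) = 0) := by decide
  have h01 : ¬((0 : Fin 3) = 1) := by decide
  have h02 : ¬((0 : Fin 3) = 2) := by decide
  have h12 : ¬((1 : Fin 3) = 2) := by decide
  have h21 : ¬((2 : Fin 3) = 1) := by decide
  rw [Fin.sum_univ_three, K.resW_eq hc hyu hyv _ (hF 0).1 (hF 0).2, K.resW_eq hc hyu hyv _ (hF 1).1 (hF 1).2, K.resW_eq hc hyu hyv _ (hF 2).1 (hF 2).2]
  unfold rowNearW cellW
  rw [K.WK_eq, K.WK_eq, K.WK_eq, ctypeM_isolate_update_eq ρ 0, ctypeM_isolate_update_eq ρ 1, ctypeM_isolate_update_eq ρ 2,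
    profM_update_eq hS huv hyu hyv hmy ρ hu hv 0, profM_update_eq hS huv hyu hyv hmy ρ hu hv 1, profM_update_eq hS huv hyu hyv hmy ρ hu hv 2,
    Function.update_self, Function.update_self, Function.update_self]
  simp only [hWt_eq_mul_fC, mem_singleton, forall_eq, Function.update_self, if_true, h10, h20, h01, h02, h12, h21, if_false,
    MGraph.capAdd_zero_right]
  rcases hc with h | h
  · subst h
    simp only [if_true, h10, h20, h01, h02, if_false, ctAdd_zero_triple, xPart_zero_eq]
    ring
  · subst h
    simp only [if_true, h10, h01, h12, h21, if_false, ctAdd_zero_triple, xPart_one_eq]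
    ring

/-- **Three-to-one and pairing**: if for every terminal-coloured `ρ` the rows of `ρ` and of `Φ_u ρ` (cells `·[x ↦ c']`) have a nonnegative sum, then
`Σ_ρ G ρ ≥ 0` (`x ∉ {u,v}`). [this work] -/
theorem sum_nonneg_of_row_pairs (x u v : V) (hux : u ≠ x) (hvx : v ≠ x) (huv : u ≠ v) (G : (V → Fin 3) → ℤ)
    (hpair : ∀ ρ : V → Fin 3, ρ u = 0 → ρ v = 1 →
      0 ≤ (∑ c' : Fin 3, G (Function.update ρ x c')) + ∑ c' : Fin 3, G (Function.update (phiU u ρ) x c')) :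
    0 ≤ ∑ ρ ∈ univ.filter (fun ρ : V → Fin 3 => ρ u = 0 ∧ ρ v = 1), G ρ := by
  set F := univ.filter (fun ρ : V → Fin 3 => ρ u = 0 ∧ ρ v = 1) with hF
  have memF : ∀ ρ, ρ ∈ F ↔ ρ u = 0 ∧ ρ v = 1 := fun ρ => by rw [hF, mem_filter]; simp
  have hrow : ∑ ρ ∈ F, ∑ c' : Fin 3, G (Function.update ρ x c') = 3 * ∑ ρ ∈ F, G ρ := by
    rw [sum_comm]
    have h3 : ∀ c' : Fin 3, ∑ ρ ∈ F, G (Function.update ρ x c') = 3 * ∑ ρ ∈ F, (if ρ x = c' then G ρ else 0) :=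
      fun c' => sum_update_eq_three_mul_col x u v hux hvx c' _
    simp only [h3]
    rw [← mul_sum, sum_comm]
    congr 1
    refine sum_congr rfl fun ρ _ => ?_
    rw [sum_ite_eq univ (ρ x), if_pos (mem_univ _)]
  have hperm : ∑ ρ ∈ F, ∑ c' : Fin 3, G (Function.update (phiU u ρ) x c') = ∑ ρ ∈ F, ∑ c' : Fin 3, G (Function.update ρ x c') := by
    refine sum_nbij' (phiU u) (phiU u) (fun ρ hρ => ?_) (fun ρ hρ => ?_) (fun ρ _ => phiU_phiU u ρ) (fun ρ _ => phiU_phiU u ρ) (fun ρ _ => rfl)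
    · obtain ⟨hu, hv⟩ := (memF ρ).1 hρ
      exact (memF _).2 ⟨by rw [phiU_self, hu], by rw [phiU_of_ne u ρ huv.symm, hv]; decide⟩
    · obtain ⟨hu, hv⟩ := (memF ρ).1 hρ
      exact (memF _).2 ⟨by rw [phiU_self, hu], by rw [phiU_of_ne u ρ huv.symm, hv]; decide⟩
  have h2 : 0 ≤ 2 * ∑ ρ ∈ F, ∑ c' : Fin 3, G (Function.update ρ x c') := by
    have hsum : (∑ ρ ∈ F, ∑ c' : Fin 3, G (Function.update ρ x c')) + ∑ ρ ∈ F, ∑ c' : Fin 3, G (Function.update ρ x c')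
        = ∑ ρ ∈ F, ((∑ c' : Fin 3, G (Function.update ρ x c')) + ∑ c' : Fin 3, G (Function.update (phiU u ρ) x c')) := by
      rw [sum_add_distrib, hperm]
    rw [two_mul, hsum]
    exact sum_nonneg fun ρ hρ => hpair ρ ((memF ρ).1 hρ).1 ((memF ρ).1 hρ).2
  rw [hrow] at h2
  linarith

/-- **NEAR STEP** (`S = {s}`, `c ∈ {0,1}`): `0 ≤ Σ resW`, hence `TI(K.isolate y) + AZW ≤ 3·TI(K)`. [this work] -/
theorem sum_resW_nonneg_near (hc : c = 0 ∨ c = 1) (hS : ∀ w, w ∈ ({s} : Finset V) ↔ (w ≠ u ∧ w ≠ v ∧ w ≠ y ∧ K.mul y w ≠ 0)) (huv : u ≠ v)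
    (hyu : y ≠ u) (hyv : y ≠ v) (hmy : K.mark y = 0) (hyu' : K.mul y u ≠ 0) :
    0 ≤ ∑ ρ ∈ univ.filter (fun ρ : V → Fin 3 => ρ u = 0 ∧ ρ v = 1), K.resW c y {s} s u v ρ := by
  have hsu : s ≠ u := ((hS s).1 (mem_singleton_self s)).1
  have hsv : s ≠ v := ((hS s).1 (mem_singleton_self s)).2.1
  have hys : K.mul y s ≠ 0 := ((hS s).1 (mem_singleton_self s)).2.2.2
  have hA : cap3 (K.mul y u) ≠ 0 := fun h => hyu' ((eq_zero_iff_cap3 _).2 h)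
  have hC : cap3 (K.mul y s) ≠ 0 := fun h => hys ((eq_zero_iff_cap3 _).2 h)
  refine sum_nonneg_of_row_pairs s u v hsu.symm hsv.symm huv _ fun ρ hu hv => ?_
  have hφu : phiU u ρ u = 0 := by rw [phiU_self, hu]
  have hφv : phiU u ρ v = 1 := by rw [phiU_of_ne u ρ huv.symm, hv]; decide
  rw [sum_resW_update_near hc hS huv hyu hyv hmy ρ hu hv, sum_resW_update_near hc hS huv hyu hyv hmy (phiU u ρ) hφu hφv]
  obtain ⟨t1, t2⟩ := ((K.isolate y).isolate s).ctypeM_pair u ρ hu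
  obtain ⟨p1, p2⟩ := (K.isolate y).profM_pair s u hsu ρ hu
  rw [t1, t2, p1, p2]
  rcases hc with h | h
  · subst h; exact near_pair_zero _ _ _ hA hC _ _ _ _ _ _ _ _ _
  · subst h; exact near_pair_one _ _ _ hA hC _ _ _ _ _ _ _ _ _

/-- **FAR STEP, weight at `v`** (`c = 1`, `S = {s'}`, `s ∉ {s', u}`): `0 ≤ Σ resW` — the two weight classes are `Φ_u`-invariant and each is g49's
paired inequality (`single_pair_nonneg`), at the base type shifted by `e₁` on the class `ρ s = 1`. [this work] -/
theorem sum_resW_nonneg_far_one (hS : ∀ w, w ∈ ({s'} : Finset V) ↔ (w ≠ u ∧ w ≠ v ∧ w ≠ y ∧ K.mul y w ≠ 0)) (huv : u ≠ v)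
    (hyu : y ≠ u) (hyv : y ≠ v) (hmy : K.mark y = 0) (hyu' : K.mul y u ≠ 0) (hss' : s ≠ s') (hsu : s ≠ u) :
    0 ≤ ∑ ρ ∈ univ.filter (fun ρ : V → Fin 3 => ρ u = 0 ∧ ρ v = 1), K.resW 1 y {s'} s u v ρ := by
  have hs'u : s' ≠ u := ((hS s').1 (mem_singleton_self s')).1
  have hs'v : s' ≠ v := ((hS s').1 (mem_singleton_self s')).2.1
  have hys' : K.mul y s' ≠ 0 := ((hS s').1 (mem_singleton_self s')).2.2.2
  have hA : cap3 (K.mul y u) ≠ 0 := fun h => hyu' ((eq_zero_iff_cap3 _).2 h)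
  have hC : cap3 (K.mul y s') ≠ 0 := fun h => hys' ((eq_zero_iff_cap3 _).2 h)
  have hc : (1 : Fin 3) = 0 ∨ (1 : Fin 3) = 1 := Or.inr rfl
  refine sum_nonneg_of_row_pairs s' u v hs'u.symm hs'v.symm huv _ fun ρ hu hv => ?_
  have hφu : phiU u ρ u = 0 := by rw [phiU_self, hu]
  have hφv : phiU u ρ v = 1 := by rw [phiU_of_ne u ρ huv.symm, hv]; decide
  have hφs : phiU u ρ s = sw02 (ρ s) := phiU_of_ne u ρ hsu
  have e1 : ∀ c' : Fin 3, K.resW 1 y {s'} s u v (Function.update ρ s' c') = K.resWL 1 y {s'} s 1 0 1 (Function.update ρ s' c') := fun c' =>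
    resW_eq_resWL hc {s'} hyu hyv _ (by rw [Function.update_of_ne hs'u.symm, hu]) (by rw [Function.update_of_ne hs'v.symm, hv])
  have e2 : ∀ c' : Fin 3, K.resW 1 y {s'} s u v (Function.update (phiU u ρ) s' c') = K.resWL 1 y {s'} s 1 0 1 (Function.update (phiU u ρ) s' c') :=
    fun c' => resW_eq_resWL hc {s'} hyu hyv _ (by rw [Function.update_of_ne hs'u.symm, hφu]) (by rw [Function.update_of_ne hs'v.symm, hφv])
  simp only [e1, e2]
  rw [sum_resWL_update_far hS huv hyu hyv hmy hss' ρ hu hv, sum_resWL_update_far hS huv hyu hyv hmy hss' (phiU u ρ) hφu hφv, hφs]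
  obtain ⟨t1, t2⟩ := ((K.isolate y).isolate s').ctypeM_pair u ρ hu
  obtain ⟨p1, p2⟩ := (K.isolate y).profM_pair s' u hs'u ρ hu
  rw [t1, t2, p1, p2]
  have s1 : ∀ z : Fin 3, sw02 z = 1 ↔ z = 1 := sw02_eq_one_iff
  by_cases h1 : ρ s = 1
  · have s11 : sw02 1 = 1 := by decide
    simp only [h1, s11, if_true, show (0 : ℤ) - 1 = -1 by norm_num, rowFarW_eq_mul_rowD1, one_mul, xPart_one_eq]
    unfold ctAdd
    simp only [MGraph.capAdd_zero_right]
    exact single_pair_nonneg _ _ _ hA hC _ _ _ _ _ _ _ _ _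
  · have h1' : ¬ sw02 (ρ s) = 1 := fun h => h1 ((s1 _).1 h)
    simp only [h1, h1', if_false, show (0 : ℤ) - 1 = -1 by norm_num, rowFarW_eq_mul_rowD1, ctAdd_zero_triple]
    exact two_mul_single_pair_nonneg _ _ _ hA hC _ _ _ _ _ _ _ _ _

/-- **FAR STEP, weight at `u`, `y ∼ v`** (`c = 0`, `S = {s'}`, `s ∉ {s', u}`, `mul y v ≠ 0`): `0 ≤ Σ resW` (law `(1,1)`; tables `far_zero_pair_z?_Bpos`). [this work] -/
theorem sum_resW_nonneg_far_zero_pos (hS : ∀ w, w ∈ ({s'} : Finset V) ↔ (w ≠ u ∧ w ≠ v ∧ w ≠ y ∧ K.mul y w ≠ 0)) (huv : u ≠ v)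
    (hyu : y ≠ u) (hyv : y ≠ v) (hmy : K.mark y = 0) (hyu' : K.mul y u ≠ 0) (hyv' : K.mul y v ≠ 0) (hss' : s ≠ s') (hsu : s ≠ u) :
    0 ≤ ∑ ρ ∈ univ.filter (fun ρ : V → Fin 3 => ρ u = 0 ∧ ρ v = 1), K.resW 0 y {s'} s u v ρ := by
  have hs'u : s' ≠ u := ((hS s').1 (mem_singleton_self s')).1
  have hs'v : s' ≠ v := ((hS s').1 (mem_singleton_self s')).2.1
  have hys' : K.mul y s' ≠ 0 := ((hS s').1 (mem_singleton_self s')).2.2.2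
  have hA : cap3 (K.mul y u) ≠ 0 := fun h => hyu' ((eq_zero_iff_cap3 _).2 h)
  have hB : cap3 (K.mul y v) ≠ 0 := fun h => hyv' ((eq_zero_iff_cap3 _).2 h)
  have hC : cap3 (K.mul y s') ≠ 0 := fun h => hys' ((eq_zero_iff_cap3 _).2 h)
  have hc : (0 : Fin 3) = 0 ∨ (0 : Fin 3) = 1 := Or.inl rfl
  refine sum_nonneg_of_row_pairs s' u v hs'u.symm hs'v.symm huv _ fun ρ hu hv => ?_
  have hφu : phiU u ρ u = 0 := by rw [phiU_self, hu]
  have hφv : phiU u ρ v = 1 := by rw [phiU_of_ne u ρ huv.symm, hv]; decide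
  have hφs : phiU u ρ s = sw02 (ρ s) := phiU_of_ne u ρ hsu
  have e1 : ∀ c' : Fin 3, K.resW 0 y {s'} s u v (Function.update ρ s' c') = K.resWL 0 y {s'} s 1 0 1 (Function.update ρ s' c') := fun c' =>
    resW_eq_resWL hc {s'} hyu hyv _ (by rw [Function.update_of_ne hs'u.symm, hu]) (by rw [Function.update_of_ne hs'v.symm, hv])
  have e2 : ∀ c' : Fin 3, K.resW 0 y {s'} s u v (Function.update (phiU u ρ) s' c') = K.resWL 0 y {s'} s 1 0 1 (Function.update (phiU u ρ) s' c') :=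
    fun c' => resW_eq_resWL hc {s'} hyu hyv _ (by rw [Function.update_of_ne hs'u.symm, hφu]) (by rw [Function.update_of_ne hs'v.symm, hφv])
  simp only [e1, e2]
  rw [sum_resWL_update_far hS huv hyu hyv hmy hss' ρ hu hv, sum_resWL_update_far hS huv hyu hyv hmy hss' (phiU u ρ) hφu hφv, hφs]
  obtain ⟨t1, t2⟩ := ((K.isolate y).isolate s').ctypeM_pair u ρ hu
  obtain ⟨p1, p2⟩ := (K.isolate y).profM_pair s' u hs'u ρ hu
  rw [t1, t2, p1, p2]
  have tri : ∀ z : Fin 3, z = 0 ∨ z = 1 ∨ z = 2 := by decide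
  have s20 : sw02 2 = 0 := by decide
  have s11 : sw02 1 = 1 := by decide
  have s02 : sw02 0 = 2 := by decide
  rcases tri (ρ s) with h | h | h
  · simp only [h, s02, if_true, show ¬((2 : Fin 3) = 0) by decide, if_false, show (0 : ℤ) - 1 = -1 by norm_num, xPart_zero_eq]
    exact far_zero_pair_z0_Bpos _ _ _ hA hC hB _ _ _ _ _ _ _ _ _
  · simp only [h, s11, show ¬((1 : Fin 3) = 0) by decide, if_false, show (0 : ℤ) - 1 = -1 by norm_num]
    exact far_zero_pair_z1_Bpos _ _ _ hA hC hB _ _ _ _ _ _ _ _ _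
  · simp only [h, s20, if_true, show ¬((2 : Fin 3) = 0) by decide, if_false, show (0 : ℤ) - 1 = -1 by norm_num, xPart_zero_eq]
    rw [add_comm]
    exact far_zero_pair_z0_Bpos _ _ _ hA hC hB _ _ _ _ _ _ _ _ _

/-- **FAR STEP, weight at `u`, `y ≁ v`** (`c = 0`, `S = {s'}`, `s ∉ {s', u}`, `mul y v = 0`): `0 ≤ Σ resWL 3 (−1) 2` — the law
`TI(K) ≥ (4/3)·TI(K−y) + (2/3)·TI(K'')` (tables `far_zero_pair_z?_B0`). [this work] -/
theorem sum_resWL_nonneg_far_zero_zero (hS : ∀ w, w ∈ ({s'} : Finset V) ↔ (w ≠ u ∧ w ≠ v ∧ w ≠ y ∧ K.mul y w ≠ 0)) (huv : u ≠ v)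
    (hyu : y ≠ u) (hyv : y ≠ v) (hmy : K.mark y = 0) (hyu' : K.mul y u ≠ 0) (hyv' : K.mul y v = 0) (hss' : s ≠ s') (hsu : s ≠ u) :
    0 ≤ ∑ ρ ∈ univ.filter (fun ρ : V → Fin 3 => ρ u = 0 ∧ ρ v = 1), K.resWL 0 y {s'} s 3 (-1) 2 ρ := by
  have hs'u : s' ≠ u := ((hS s').1 (mem_singleton_self s')).1
  have hs'v : s' ≠ v := ((hS s').1 (mem_singleton_self s')).2.1
  have hys' : K.mul y s' ≠ 0 := ((hS s').1 (mem_singleton_self s')).2.2.2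
  have hA : cap3 (K.mul y u) ≠ 0 := fun h => hyu' ((eq_zero_iff_cap3 _).2 h)
  have hB : cap3 (K.mul y v) = 0 := (eq_zero_iff_cap3 _).1 hyv'
  have hC : cap3 (K.mul y s') ≠ 0 := fun h => hys' ((eq_zero_iff_cap3 _).2 h)
  refine sum_nonneg_of_row_pairs s' u v hs'u.symm hs'v.symm huv _ fun ρ hu hv => ?_
  have hφu : phiU u ρ u = 0 := by rw [phiU_self, hu]
  have hφv : phiU u ρ v = 1 := by rw [phiU_of_ne u ρ huv.symm, hv]; decide
  have hφs : phiU u ρ s = sw02 (ρ s) := phiU_of_ne u ρ hsu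
  rw [sum_resWL_update_far hS huv hyu hyv hmy hss' ρ hu hv, sum_resWL_update_far hS huv hyu hyv hmy hss' (phiU u ρ) hφu hφv, hφs, hB]
  obtain ⟨t1, t2⟩ := ((K.isolate y).isolate s').ctypeM_pair u ρ hu
  obtain ⟨p1, p2⟩ := (K.isolate y).profM_pair s' u hs'u ρ hu
  rw [t1, t2, p1, p2]
  have tri : ∀ z : Fin 3, z = 0 ∨ z = 1 ∨ z = 2 := by decide
  have s20 : sw02 2 = 0 := by decide
  have s11 : sw02 1 = 1 := by decide
  have s02 : sw02 0 = 2 := by decide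
  rcases tri (ρ s) with h | h | h
  · simp only [h, s02, if_true, show ¬((2 : Fin 3) = 0) by decide, if_false, show (-1 : ℤ) - 2 = -3 by norm_num, xPart_zero_eq]
    exact far_zero_pair_z0_B0 _ _ hA hC _ _ _ _ _ _ _ _ _
  · simp only [h, s11, show ¬((1 : Fin 3) = 0) by decide, if_false, show (-1 : ℤ) - 2 = -3 by norm_num]
    exact far_zero_pair_z1_B0 _ _ hA hC _ _ _ _ _ _ _ _ _
  · simp only [h, s20, if_true, show ¬((2 : Fin 3) = 0) by decide, if_false, show (-1 : ℤ) - 2 = -3 by norm_num, xPart_zero_eq]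
    rw [add_comm]
    exact far_zero_pair_z0_B0 _ _ hA hC _ _ _ _ _ _ _ _ _

end StepOneW

end MGraph

end Summit.CriticalPhenomena.PercolationContinuityZ3.Theorems.SunflowerPartition.Kempe
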